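import Literature.AlgebraicGeometry.Frobenioids.DivisorialDescriptionsThm51ii
import Literature.AlgebraicGeometry.Frobenioids.IrreducibleMorphismsCounterexample
import HarnessLib

/-!
# Frobenioids I, Theorem 5.1 (i)/(ii): the named schemata `Thm51i_bijection`,
# `Thm51i_frobenius`, `Thm51ii_exists_iff` — instance-form witnesses and the kernel `¬∀Ψ`

Mochizuki, *The geometry of Frobenioids I: the general theory*, Kyushu J. Math. **62** (2008)
293–400, §5, Theorem 5.1 (i), (ii), kurims text pp. 96–97 (statement), pp. 97–99 (proof)
[cite: MochizukiFrdI2008, Thm. 5.1 p.96].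

PROOF-ONLY companion of `DivisorialDescriptions.lean` (abc-iut-L1-t5; its declarations are imported,
never edited or restated). The three named statements of Theorem 5.1 (i)/(ii) in that file are typed
over a PARAMETER `Ψ : GpSubfunctor Φ` ("GENERAL FORM over the parameter `Ψ` … a schema while `Ψ` is
free; the closed statement of the text is the instantiation … `Ψ := biratSubfunctor F`", loc. cit.),
i.e. over an arbitrary subfunctor of groups `Ψ ⊆ Φ^gp`; the text has `Pic_Φ(A) := Φ^gp(A)/Φ^birat(A)`
[cf. Proposition 4.4, (iii)], p. 96. This file records, kernel-checked:

* **the instance forms the text states and the consumers cite** (`Ψ := Φ^birat = biratSubfunctor F`):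
  `thm51i_bijection_holds`, `thm51i_frobenius_holds`, `thm51ii_exists_iff_holds` — each is, BY NAME,
  a component of the landed `PreFrobenioid.thm51i_holds : Thm51i F A` (abc-iut-L1-t10,
  `DivisorialDescriptionsProofs.lean`) resp. the landed `PreFrobenioid.thm51ii_holds : Thm51ii F A A'`
  (`DivisorialDescriptionsThm51ii.lean`); nothing is re-proved here;
* **the universal closures over `Ψ` are FALSE** (`not_thm51i_bijection_bot`, `not_thm51i_frobenius_bot`,
  `not_thm51ii_exists_iff_bot` and the `not_forall_…` corollaries): in the *standard Frobenioid*
  `F_Φ → F_{Φ^char}`, `Φ = Φ_{ℤ_{≥0}}` the constant monoid `(ℤ_{≥0}, +)` on the one-morphism category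
  (Def. 1.1 (iii); a Frobenioid of isotropic type with every object Frobenius-trivial, Prop. 1.5 (i) —
  `StandardFrobenioidExample` of `IrreducibleMorphismsCounterexample.lean`, abc-iut-L1 lineage), take
  for `Ψ` the TRIVIAL subfunctor `0 ⊆ Φ^gp` instead of `Φ^birat`: then `Φ^gp(A)/Ψ(A) = ℤ`, whereas all
  objects of `C ×_D D^isom_{A_D}` are isomorphic (`Pic_C(A)` is one point); the `A`-pairs `(id, id)` and
  `(id, (id, 1, 1))` have classes `0 ≠ 1` in `ℤ` but the same class in `Pic_C(A)` — against (i); with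
  `κ = id` (a morphism of Frobenius type of degree `1`) the "Moreover" of (i) would force `1 = 1 · 0`;
  and in (ii) with `d = 1`, `θ = id`, `z = 1 ∈ ℤ_{≥0}` the morphism `(id, 1, 1)` has the prescribed
  data while `d · β + z|_{A_D} = 1 ≠ 0 = Φ(θ)(β')` (`β = β' = 0`).

So the FACT-LIST rows F-1060/F-1061/F-1062 (abc-iut cell) are SCHEMATA whose universal closure is
refuted and whose printed instance (`Ψ = Φ^birat`) is proved; this says nothing against the text,
whose `Pic_Φ(A)` IS the instance. No definitions; theorems only.
-/

namespace Literature.AlgebraicGeometry.Frobenioids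

open CategoryTheory Opposite

universe w v v' u u'

namespace PreFrobenioid

variable {D : Type u} [Category.{v} D] {Φ : Dᵒᵖ ⥤ CommMonCat.{w}}
  {C : Type u'} [Category.{v'} C] (F : C ⥤ ElemFrobenioid Φ)

/-! ### The printed instance `Ψ := Φ^birat`: witnesses by name -/

/-- **[FrdI] Theorem 5.1 (i), bijection clause, at the printed instance `Pic_Φ(A) = Φ^gp(A)/Φ^birat(A)`**
(FACT-LIST F-1060): for `C` a Frobenioid of isotropic type and `A` Frobenius-trivial, the two
assignments of an `A`-pair `(φ : B → A, ψ : B → C)` — to `(C, Base(φ) ∘ Base(ψ)⁻¹) ∈ Ob(C ×_D D^isom_{A_D})`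
and to `Φ(φ)⁻¹(Div(ψ) − Div(φ)) ∈ Φ^gp(A)` — "determine a bijection `Pic_Φ(A) ⥲ Pic_C(A)`" (p. 96).
This is the first component of the landed `thm51i_holds` (abc-iut-L1-t10), by name.
[cite: MochizukiFrdI2008, Thm. 5.1 (i) p.96] -/
theorem thm51i_bijection_holds (A : C) :
    Literature.AlgebraicGeometry.Frobenioids.PreFrobenioid.Thm51i_bijection F
      (Literature.AlgebraicGeometry.Frobenioids.PreFrobenioid.biratSubfunctor F) A :=
  (thm51i_holds F A).1

/-- **[FrdI] Theorem 5.1 (i), "Moreover" (compatibility with morphisms of Frobenius type), at the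
printed instance `Ψ = Φ^birat`** (FACT-LIST F-1061): "if `(C, ζ : C_D ⥲ A_D)` corresponds, via this
bijection, to `γ ∈ Pic_Φ(A)`, and `κ : C → C'` is a morphism of Frobenius type, then
`(C', ζ ∘ Base(κ)⁻¹)` corresponds to `deg_Fr(κ) · γ ∈ Pic_Φ(A)`" (p. 96). Second component of the landed
`thm51i_holds`, by name. [cite: MochizukiFrdI2008, Thm. 5.1 (i) p.96] -/
theorem thm51i_frobenius_holds (A : C) :
    Literature.AlgebraicGeometry.Frobenioids.PreFrobenioid.Thm51i_frobenius F
      (Literature.AlgebraicGeometry.Frobenioids.PreFrobenioid.biratSubfunctor F) A :=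
  (thm51i_holds F A).2

/-- **[FrdI] Theorem 5.1 (ii), existence criterion, at the printed instance `Ψ = Φ^birat`**
(FACT-LIST F-1062): for Frobenius-trivial `A, A'` and `(B, λ)`, `(B', λ')`, "there exists a morphism
`φ : B → B'` in `C` of Frobenius degree `d` such that `Base(φ) = (λ')⁻¹ ∘ θ ∘ λ` … and `Div(φ) = z` if and
only if … `d · β + z|_{A_D} = (Φ(θ))(β')` in `Pic_Φ(A)`" (pp. 96–97). This IS the landed
`thm51ii_holds : Thm51ii F A A'` (`Thm51ii` is by definition `Thm51ii_exists_iff F (biratSubfunctor F)`),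
by name. [cite: MochizukiFrdI2008, Thm. 5.1 (ii) p.97] -/
theorem thm51ii_exists_iff_holds (A A' : C) :
    Literature.AlgebraicGeometry.Frobenioids.PreFrobenioid.Thm51ii_exists_iff F
      (Literature.AlgebraicGeometry.Frobenioids.PreFrobenioid.biratSubfunctor F) A A' :=
  thm51ii_holds F A A'

end PreFrobenioid

/-! ### The universal closures over `Ψ` fail: `Ψ = 0` in the standard Frobenioid -/

namespace StandardFrobenioidExample

open PreFrobenioid

/-- The identity of the object `A` of the standard Frobenioid is a pre-step.
[cite: MochizukiFrdI2008, Def. 1.2(iii) p.23] -/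
theorem isPreStep_id_A : IsPreStep (ElemFrobenioid.toChar Φst) (𝟙 A) :=
  ⟨rfl, show IsIso (𝟙 _) from inferInstance⟩

/-- The identity of `A` is a morphism of Frobenius type (of Frobenius degree `1`).
[cite: MochizukiFrdI2008, Def. 1.2(iii) p.23] -/
theorem isFrobeniusType_id_A : IsFrobeniusType (ElemFrobenioid.toChar Φst) (𝟙 A) :=
  ⟨⟨ElemFrobenioid.isCoAngular _, Associates.mk_one⟩, show IsIso (𝟙 _) from inferInstance⟩

/-- In the standard Frobenioid all objects `(C, ζ)` of `C ×_D D^isom_{A_D}` are isomorphic: `Pic_C(A)` is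
a point (the base category has exactly one morphism). [cite: MochizukiFrdI2008, Thm. 5.1 (i) p.96] -/
theorem picC_subsingleton
    (X Y : IsomOver (ElemFrobenioid.toChar Φst) (baseObj (ElemFrobenioid.toChar Φst) A)) :
    (⟦X⟧ : PicC (ElemFrobenioid.toChar Φst) (baseObj (ElemFrobenioid.toChar Φst) A)) = ⟦Y⟧ := by
  refine Quotient.sound ⟨?_, Subsingleton.elim _ _⟩
  exact ⟨ElemFrobenioid.homMk (eqToHom (Subsingleton.elim _ _)) 1 1,
    ElemFrobenioid.homMk (eqToHom (Subsingleton.elim _ _)) 1 1,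
    ElemFrobenioid.Hom.ext (Subsingleton.elim _ _) (by simp) rfl,
    ElemFrobenioid.Hom.ext (Subsingleton.elim _ _) (by simp) rfl⟩

/-- The class `Φ(id)⁻¹(Div(id) − Div(id)) = 0` of the `A`-pair `(id, id)` in `Φ^gp(A)`.
[cite: MochizukiFrdI2008, Thm. 5.1 (i) p.96] -/
theorem cls_pair_id_id :
    (⟨A, A, 𝟙 A, 𝟙 A, isPreStep_id_A, isPreStep_id_A⟩ : APair (ElemFrobenioid.toChar Φst) A).cls = 1 :=
  div_self' _

/-- The class `Φ(id)⁻¹(Div(id, 1, 1) − Div(id)) = 1` of the `A`-pair `(id, (id, 1, 1))` in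
`Φ^gp(A) = (ℤ_{≥0}^char)^gp`. [cite: MochizukiFrdI2008, Thm. 5.1 (i) p.96] -/
theorem cls_pair_id_stepOne :
    (⟨A, A, 𝟙 A, stepOne A, isPreStep_id_A, isPreStep_stepOne A⟩ :
        APair (ElemFrobenioid.toChar Φst) A).cls =
      Algebra.GrothendieckGroup.of (Associates.mk (Multiplicative.ofAdd (1 : ℕ)) : Associates M) := by
  change Algebra.GrothendieckGroup.of (Associates.mk (Multiplicative.ofAdd (1 : ℕ)) : Associates M) /
      Algebra.GrothendieckGroup.of (Associates.mk (1 : M)) = _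
  rw [Associates.mk_one, MonoidHom.map_one, div_one]

/-- The image of `1 ∈ ℤ_{≥0}` in `(ℤ_{≥0}^char)^gp = ℤ` is not `0` (`ℤ_{≥0}^char` is integral and
`1 ∈ ℤ_{≥0}` is not a unit). [cite: MochizukiFrdI2008, §0 p.11] -/
theorem of_mk_one_ne_one :
    (Algebra.GrothendieckGroup.of (Associates.mk (Multiplicative.ofAdd (1 : ℕ)) : Associates M)) ≠ 1 := by
  intro h
  have hinj := isPreDivisorial_M.isDivisorial_associates.isPreDivisorial.isIntegral.injective_of
  have h1 : (Associates.mk (Multiplicative.ofAdd (1 : ℕ) : M)) = 1 := hinj (h.trans (map_one _).symm)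
  rw [Associates.mk_eq_one] at h1
  exact absurd (eq_one_of_isUnit_M _ h1) (by decide)

/-- **The universal closure of `Thm51i_bijection` over `Ψ` is false** (FACT-LIST F-1060 is a schema):
in the standard Frobenioid, with `Ψ = 0 ⊆ Φ^gp` (so `Φ^gp(A)/Ψ(A) = ℤ`), the `A`-pairs `(id, id)` and
`(id, (id, 1, 1))` have the same class in `Pic_C(A)` but classes `0 ≠ 1` in `ℤ`. The printed instance
`Ψ = Φ^birat` holds (`PreFrobenioid.thm51i_bijection_holds`). [cite: MochizukiFrdI2008, Thm. 5.1 (i) p.96] -/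
theorem not_thm51i_bijection_bot :
    ¬ Literature.AlgebraicGeometry.Frobenioids.PreFrobenioid.Thm51i_bijection (ElemFrobenioid.toChar Φst)
        ⟨fun _ => ⊥, fun f _ hc => by
          rw [Subgroup.mem_bot] at hc ⊢
          rw [hc, map_one]⟩ A := by
  intro h
  obtain ⟨hbij, -, -⟩ := h isFrobenioid isOfIsotropicType (ElemFrobenioid.isFrobeniusTrivial A)
  have h1 := (hbij ⟨A, A, 𝟙 A, 𝟙 A, isPreStep_id_A, isPreStep_id_A⟩
    ⟨A, A, 𝟙 A, stepOne A, isPreStep_id_A, isPreStep_stepOne A⟩).mpr (picC_subsingleton _ _)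
  have h2 : (⟨A, A, 𝟙 A, 𝟙 A, isPreStep_id_A, isPreStep_id_A⟩ :
        APair (ElemFrobenioid.toChar Φst) A).cls /
      (⟨A, A, 𝟙 A, stepOne A, isPreStep_id_A, isPreStep_stepOne A⟩ :
        APair (ElemFrobenioid.toChar Φst) A).cls ∈ (⊥ : Subgroup _) :=
    QuotientGroup.eq_iff_div_mem.mp h1
  rw [Subgroup.mem_bot, cls_pair_id_id, cls_pair_id_stepOne, one_div, inv_eq_one] at h2
  exact of_mk_one_ne_one h2

/-- **The universal closure of `Thm51i_frobenius` over `Ψ` is false** (FACT-LIST F-1061 is a schema):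
in the standard Frobenioid with `Ψ = 0`, for `κ = id_A` (a morphism of Frobenius type of degree `1`)
and the representatives `(id, id)` of `(A, ζ)` and `(id, (id, 1, 1))` of `(A, ζ ∘ Base(κ)⁻¹)` (every
object of `C ×_D D^isom_{A_D}` represents every class) the clause would give `1 = 1 · 0` in `ℤ`. The
printed instance `Ψ = Φ^birat` holds (`PreFrobenioid.thm51i_frobenius_holds`).
[cite: MochizukiFrdI2008, Thm. 5.1 (i) p.96] -/
theorem not_thm51i_frobenius_bot :
    ¬ Literature.AlgebraicGeometry.Frobenioids.PreFrobenioid.Thm51i_frobenius (ElemFrobenioid.toChar Φst)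
        ⟨fun _ => ⊥, fun f _ hc => by
          rw [Subgroup.mem_bot] at hc ⊢
          rw [hc, map_one]⟩ A := by
  intro h
  have h1 := h isFrobenioid isOfIsotropicType (ElemFrobenioid.isFrobeniusTrivial A)
    (APair.toIsomOver ⟨A, A, 𝟙 A, 𝟙 A, isPreStep_id_A, isPreStep_id_A⟩) (𝟙 A) isFrobeniusType_id_A
    ⟨A, A, 𝟙 A, 𝟙 A, isPreStep_id_A, isPreStep_id_A⟩
    ⟨A, A, 𝟙 A, stepOne A, isPreStep_id_A, isPreStep_stepOne A⟩ rfl (picC_subsingleton _ _)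
  rw [cls_pair_id_id, cls_pair_id_stepOne, QuotientGroup.mk_one, one_pow, QuotientGroup.eq_one_iff] at h1
  have h2 : (Algebra.GrothendieckGroup.of (Associates.mk (Multiplicative.ofAdd (1 : ℕ)) : Associates M))
      ∈ (⊥ : Subgroup _) := h1
  rw [Subgroup.mem_bot] at h2
  exact of_mk_one_ne_one h2

/-- **The universal closure of `Thm51ii_exists_iff` over `Ψ` is false** (FACT-LIST F-1062 is a schema):
in the standard Frobenioid with `Ψ = 0`, `A = A'`, `(B, λ) = (B', λ')` represented by the `A`-pair
`(id, id)` (`β = β' = 0`), `d = 1`, `θ = id`, `z = 1 ∈ ℤ_{≥0}`: the morphism `(id, 1, 1) : B → B'` has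
Frobenius degree `1`, the prescribed projection and `Div = z`, yet `d · β + z|_{A_D} = 1 ≠ 0 = Φ(θ)(β')`
in `ℤ`. The printed instance `Ψ = Φ^birat` holds (`PreFrobenioid.thm51ii_exists_iff_holds`).
[cite: MochizukiFrdI2008, Thm. 5.1 (ii) p.97] -/
theorem not_thm51ii_exists_iff_bot :
    ¬ Literature.AlgebraicGeometry.Frobenioids.PreFrobenioid.Thm51ii_exists_iff (ElemFrobenioid.toChar Φst)
        ⟨fun _ => ⊥, fun f _ hc => by
          rw [Subgroup.mem_bot] at hc ⊢
          rw [hc, map_one]⟩ A A := by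
  intro h
  have h1 := h isFrobenioid isOfIsotropicType (ElemFrobenioid.isFrobeniusTrivial A)
    (ElemFrobenioid.isFrobeniusTrivial A)
    (APair.toIsomOver ⟨A, A, 𝟙 A, 𝟙 A, isPreStep_id_A, isPreStep_id_A⟩)
    (APair.toIsomOver ⟨A, A, 𝟙 A, 𝟙 A, isPreStep_id_A, isPreStep_id_A⟩)
    ⟨A, A, 𝟙 A, 𝟙 A, isPreStep_id_A, isPreStep_id_A⟩
    ⟨A, A, 𝟙 A, 𝟙 A, isPreStep_id_A, isPreStep_id_A⟩ rfl rfl 1 (𝟙 _)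
    (Associates.mk (Multiplicative.ofAdd (1 : ℕ)) : Associates M)
  have h2 := h1.mp ⟨stepOne A, rfl, Subsingleton.elim _ _, rfl⟩
  rw [cls_pair_id_id, QuotientGroup.mk_one, one_pow, one_mul, MonoidHom.map_one, QuotientGroup.eq_one_iff] at h2
  have h3 : (Algebra.GrothendieckGroup.of (Associates.mk (Multiplicative.ofAdd (1 : ℕ)) : Associates M))
      ∈ (⊥ : Subgroup _) := h2
  rw [Subgroup.mem_bot] at h3
  exact of_mk_one_ne_one h3

/-- Corollary: the closure of `Thm51i_bijection` over ALL its binders (in particular over the subfunctor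
`Ψ ⊆ Φ^gp`) is false. [cite: MochizukiFrdI2008, Thm. 5.1 (i) p.96] -/
theorem not_forall_thm51i_bijection :
    ¬ ∀ {D : Type} [Category.{0} D] {Φ : Dᵒᵖ ⥤ CommMonCat.{0}} {C : Type} [Category.{0} C]
        (F : C ⥤ ElemFrobenioid Φ) (Ψ : GpSubfunctor Φ) (A : C),
        Literature.AlgebraicGeometry.Frobenioids.PreFrobenioid.Thm51i_bijection F Ψ A :=
  fun h => not_thm51i_bijection_bot (h _ _ _)

/-- Corollary: the closure of `Thm51i_frobenius` over ALL its binders is false.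
[cite: MochizukiFrdI2008, Thm. 5.1 (i) p.96] -/
theorem not_forall_thm51i_frobenius :
    ¬ ∀ {D : Type} [Category.{0} D] {Φ : Dᵒᵖ ⥤ CommMonCat.{0}} {C : Type} [Category.{0} C]
        (F : C ⥤ ElemFrobenioid Φ) (Ψ : GpSubfunctor Φ) (A : C),
        Literature.AlgebraicGeometry.Frobenioids.PreFrobenioid.Thm51i_frobenius F Ψ A :=
  fun h => not_thm51i_frobenius_bot (h _ _ _)

/-- Corollary: the closure of `Thm51ii_exists_iff` over ALL its binders is false.
[cite: MochizukiFrdI2008, Thm. 5.1 (ii) p.97] -/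
theorem not_forall_thm51ii_exists_iff :
    ¬ ∀ {D : Type} [Category.{0} D] {Φ : Dᵒᵖ ⥤ CommMonCat.{0}} {C : Type} [Category.{0} C]
        (F : C ⥤ ElemFrobenioid Φ) (Ψ : GpSubfunctor Φ) (A A' : C),
        Literature.AlgebraicGeometry.Frobenioids.PreFrobenioid.Thm51ii_exists_iff F Ψ A A' :=
  fun h => not_thm51ii_exists_iff_bot (h _ _ _ _)

end StandardFrobenioidExample

end Literature.AlgebraicGeometry.Frobenioids
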